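import Summits.ValiantsHypothesis.ValiantsHypothesis.Theorems.MonotoneRestorationOrbitRestorationQPActionSignCount
import HarnessLib

/-!
# The sign counts that key rule M2′, and their invariance (ORBIT currency, ΠΣ sub-rung: plan item L5, first half)

Route MonotoneRestoration, crux `OrbitRestorationQP` (stmt-ValiantsHypothesis-18293), line `depth-three-rung`,
stub A₁ `stub_piSigmaValue`, namespace `Summit.ValiantsHypothesis.ValiantsHypothesis.Theorems.KeyCounts`.

Rule M2′ (evidence `A1-M2PRIME-PROOF.md` on the crux item, §1) keys a polynomial `q` by `R q`, `C q` or `R q ∪ C q`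
according to the parities of two counts taken inside the multiset `L` of factors:

  `nr q = #{ℓ ∈ L : R ℓ = R q, C ℓ = C q, |R q| = 2, the row transposition of R q negates ℓ}`,
  `nc q = #{ℓ ∈ L : R ℓ = R q, C ℓ = C q, |C q| = 2, the column transposition of C q negates ℓ}`

(written inline below as cardinalities of filters; no definitions are introduced).  For the key to be EQUIVARIANT
these counts must be invariant under the row, column and diagonal actions on `q`.  This file proves that:

* `card_filter_eq_of_transport` — abstract transport: if an automorphism `θ` maps `L` to itself up to units and
  carries a predicate `P` to a unit-invariant predicate `P'` (`P' (θ ℓ) ↔ P ℓ`), then `#{ℓ ∈ L : P' ℓ} = #{ℓ ∈ L : P ℓ}`;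
* `rowNeg_iff_of_row`, `rowNeg_iff_of_col`, `colNeg_iff_of_col`, `colNeg_iff_of_row` — how the negation predicates
  move under the actions (`(σx σy) = σ (x y) σ⁻¹`; rows and columns commute);
* **`rowCount_row`, `rowCount_col`, `colCount_col`, `colCount_row`** — the fibre counts over `(σ • A, B)` and
  `(A, τ • B)` equal those over `(A, B)`; hence **`rowCount_ren`, `colCount_ren`** for the diagonal action.

Everything is proved. [folklore]

## References
* A. Dawar, G. Wilsenach, *Symmetric arithmetic circuits*, ToC 21 (2025), §3.3, Def. 6.1. [DawarWilsenach2025]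
-/

noncomputable section

open scoped Classical Pointwise

-- `Summit.ValiantsHypothesis.ValiantsHypothesis.…` is the tree's single-conjunct layout (Sub = Summit).
set_option linter.dupNamespace false

namespace Summit.ValiantsHypothesis.ValiantsHypothesis.Theorems

namespace KeyCounts

open Equiv Finset ProductAction

variable {n : ℕ}

/-! ### Abstract transport of a count -/

/-- **Transport of a count along an automorphism.**  If `θ · L` and `L` have the same associates, `P'` respects
associates and `P' (θ ℓ) ↔ P ℓ` for all `ℓ`, then `#{ℓ ∈ L : P' ℓ} = #{ℓ ∈ L : P ℓ}`. [folklore] -/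
theorem card_filter_eq_of_transport (θ : MvPolynomial (Fin n × Fin n) ℂ ≃ₐ[ℂ] MvPolynomial (Fin n × Fin n) ℂ)
    {L : Multiset (MvPolynomial (Fin n × Fin n) ℂ)}
    (hmk : (L.map θ).map Associates.mk = L.map Associates.mk)
    (P P' : MvPolynomial (Fin n × Fin n) ℂ → Prop) [DecidablePred P] [DecidablePred P']
    (hP' : ∀ p q : MvPolynomial (Fin n × Fin n) ℂ, Associated p q → (P' p ↔ P' q))
    (hPP' : ∀ ℓ, P' (θ ℓ) ↔ P ℓ) :
    Multiset.card (L.filter P') = Multiset.card (L.filter P) := by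
  have h1 := SupportBlocks.map_mk_filter_eq hP' hmk
  have h2 : (L.map θ).filter P' = (L.filter P).map θ := by
    rw [Multiset.filter_map]
    congr 1
    exact Multiset.filter_congr fun ℓ _ => by simp only [Function.comp_apply, hPP']
  rw [h2] at h1
  have h3 := congrArg Multiset.card h1
  simpa using h3.symm

/-- Negation by an automorphism is a property of the line (unit-invariant). [folklore] -/
theorem neg_iff_of_C_mul (θ : MvPolynomial (Fin n × Fin n) ℂ ≃ₐ[ℂ] MvPolynomial (Fin n × Fin n) ℂ)
    {c : ℂ} (hc : c ≠ 0) (q : MvPolynomial (Fin n × Fin n) ℂ) :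
    θ (MvPolynomial.C c * q) = -(MvPolynomial.C c * q) ↔ θ q = -q := by
  rw [map_mul, ActionSignCount.aut_C, ← mul_neg]
  constructor
  · intro h
    exact mul_left_cancel₀ (show (MvPolynomial.C c : MvPolynomial (Fin n × Fin n) ℂ) ≠ 0 by
      rw [Ne, MvPolynomial.C_eq_zero]; exact hc) h
  · intro h; rw [h]

/-! ### How the negation predicates move -/

/-- Row transposition after a row permutation: `ρ_{(σx σy)} (ρ_σ ℓ) = -ρ_σ ℓ ↔ ρ_{(x y)} ℓ = -ℓ`. [folklore] -/
theorem rowNeg_iff_of_row (σ : Perm (Fin n)) (x y : Fin n) (ℓ : MvPolynomial (Fin n × Fin n) ℂ) :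
    vact (K := ℂ) rowHom (swap (σ x) (σ y)) (vact (K := ℂ) rowHom σ ℓ) = -vact (K := ℂ) rowHom σ ℓ ↔
      vact (K := ℂ) rowHom (swap x y) ℓ = -ℓ := by
  rw [swap_apply_apply, ← AlgEquiv.mul_apply, ← map_mul, inv_mul_cancel_right, map_mul, AlgEquiv.mul_apply,
    ← map_neg]
  exact (vact (K := ℂ) rowHom σ).injective.eq_iff

/-- Row transposition after a column permutation: `ρ_{(x y)} (κ_τ ℓ) = -κ_τ ℓ ↔ ρ_{(x y)} ℓ = -ℓ`. [folklore] -/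
theorem rowNeg_iff_of_col (τ : Perm (Fin n)) (x y : Fin n) (ℓ : MvPolynomial (Fin n × Fin n) ℂ) :
    vact (K := ℂ) rowHom (swap x y) (vact (K := ℂ) colHom τ ℓ) = -vact (K := ℂ) colHom τ ℓ ↔
      vact (K := ℂ) rowHom (swap x y) ℓ = -ℓ := by
  rw [RowColSupport.row_col_comm, ← map_neg]
  exact (vact (K := ℂ) colHom τ).injective.eq_iff

/-- Column transposition after a column permutation. [folklore] -/
theorem colNeg_iff_of_col (τ : Perm (Fin n)) (x y : Fin n) (ℓ : MvPolynomial (Fin n × Fin n) ℂ) :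
    vact (K := ℂ) colHom (swap (τ x) (τ y)) (vact (K := ℂ) colHom τ ℓ) = -vact (K := ℂ) colHom τ ℓ ↔
      vact (K := ℂ) colHom (swap x y) ℓ = -ℓ := by
  rw [swap_apply_apply, ← AlgEquiv.mul_apply, ← map_mul, inv_mul_cancel_right, map_mul, AlgEquiv.mul_apply,
    ← map_neg]
  exact (vact (K := ℂ) colHom τ).injective.eq_iff

/-- Column transposition after a row permutation. [folklore] -/
theorem colNeg_iff_of_row (σ : Perm (Fin n)) (x y : Fin n) (ℓ : MvPolynomial (Fin n × Fin n) ℂ) :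
    vact (K := ℂ) colHom (swap x y) (vact (K := ℂ) rowHom σ ℓ) = -vact (K := ℂ) rowHom σ ℓ ↔
      vact (K := ℂ) colHom (swap x y) ℓ = -ℓ := by
  rw [← RowColSupport.row_col_comm, ← map_neg]
  exact (vact (K := ℂ) rowHom σ).injective.eq_iff

/-! ### Invariance of the two counts -/

section Counts

variable (R C : MvPolynomial (Fin n × Fin n) ℂ → Finset (Fin n))
  {L : Multiset (MvPolynomial (Fin n × Fin n) ℂ)} {a : ℂ}

/-- **The row count is invariant under the row action**: the count over the fibre `(σ • A, B)` equals the count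
over `(A, B)`. [folklore] -/
theorem rowCount_row
    (R1 : ∀ (q : MvPolynomial (Fin n × Fin n) ℂ) (u : ℂ), u ≠ 0 → R (MvPolynomial.C u * q) = R q)
    (C1 : ∀ (q : MvPolynomial (Fin n × Fin n) ℂ) (u : ℂ), u ≠ 0 → C (MvPolynomial.C u * q) = C q)
    (R2 : ∀ (q : MvPolynomial (Fin n × Fin n) ℂ) (σ : Perm (Fin n)), R (vact (K := ℂ) rowHom σ q) = σ • R q)
    (CR : ∀ (q : MvPolynomial (Fin n × Fin n) ℂ) (σ : Perm (Fin n)), C (vact (K := ℂ) rowHom σ q) = C q)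
    (hL1 : ∀ ℓ ∈ L, ℓ.totalDegree = 1) (hf0 : MvPolynomial.C a * L.prod ≠ 0)
    (hrow : ∀ σ : Perm (Fin n), vact (K := ℂ) rowHom σ (MvPolynomial.C a * L.prod) = MvPolynomial.C a * L.prod)
    (σ : Perm (Fin n)) (A B : Finset (Fin n)) :
    Multiset.card (L.filter fun ℓ => R ℓ = σ • A ∧ C ℓ = B ∧ ((σ • A).card = 2 ∧
        ∀ x ∈ σ • A, ∀ y ∈ σ • A, x ≠ y → vact (K := ℂ) rowHom (swap x y) ℓ = -ℓ)) =
      Multiset.card (L.filter fun ℓ => R ℓ = A ∧ C ℓ = B ∧ (A.card = 2 ∧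
        ∀ x ∈ A, ∀ y ∈ A, x ≠ y → vact (K := ℂ) rowHom (swap x y) ℓ = -ℓ)) := by
  refine card_filter_eq_of_transport (vact (K := ℂ) rowHom σ) (ActionSignCount.map_mk_map_vact_eq rowHom hL1 hf0 hrow σ)
    _ _ (fun p q hpq => ?_) (fun ℓ => ?_)
  · obtain ⟨c, hc0, rfl⟩ := SupportBlocks.exists_C_of_associated hpq
    simp only [R1 p c hc0, C1 p c hc0, neg_iff_of_C_mul _ hc0]
  · simp only [R2, CR, card_smul_finset]
    constructor
    · rintro ⟨hR, hC, h2, hneg⟩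
      refine ⟨by simpa using congrArg (fun s => σ⁻¹ • s) hR, hC, h2, fun x hx y hy hxy => ?_⟩
      have := hneg (σ x) (smul_mem_smul_finset hx) (σ y) (smul_mem_smul_finset hy)
        (fun h => hxy (σ.injective h))
      exact (rowNeg_iff_of_row σ x y ℓ).1 this
    · rintro ⟨hR, hC, h2, hneg⟩
      refine ⟨by rw [hR], hC, h2, fun x hx y hy hxy => ?_⟩
      obtain ⟨x', hx', rfl⟩ := mem_smul_finset.1 hx
      obtain ⟨y', hy', rfl⟩ := mem_smul_finset.1 hy
      rw [Perm.smul_def, Perm.smul_def] at hxy ⊢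
      exact (rowNeg_iff_of_row σ x' y' ℓ).2 (hneg x' hx' y' hy' fun h => hxy (by rw [h]))

/-- **The row count is invariant under the column action**: the count over `(A, τ • B)` equals the count over
`(A, B)`. [folklore] -/
theorem rowCount_col
    (R1 : ∀ (q : MvPolynomial (Fin n × Fin n) ℂ) (u : ℂ), u ≠ 0 → R (MvPolynomial.C u * q) = R q)
    (C1 : ∀ (q : MvPolynomial (Fin n × Fin n) ℂ) (u : ℂ), u ≠ 0 → C (MvPolynomial.C u * q) = C q)
    (C2 : ∀ (q : MvPolynomial (Fin n × Fin n) ℂ) (τ : Perm (Fin n)), C (vact (K := ℂ) colHom τ q) = τ • C q)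
    (RC : ∀ (q : MvPolynomial (Fin n × Fin n) ℂ) (τ : Perm (Fin n)), R (vact (K := ℂ) colHom τ q) = R q)
    (hL1 : ∀ ℓ ∈ L, ℓ.totalDegree = 1) (hf0 : MvPolynomial.C a * L.prod ≠ 0)
    (hcol : ∀ τ : Perm (Fin n), vact (K := ℂ) colHom τ (MvPolynomial.C a * L.prod) = MvPolynomial.C a * L.prod)
    (τ : Perm (Fin n)) (A B : Finset (Fin n)) :
    Multiset.card (L.filter fun ℓ => R ℓ = A ∧ C ℓ = τ • B ∧ (A.card = 2 ∧
        ∀ x ∈ A, ∀ y ∈ A, x ≠ y → vact (K := ℂ) rowHom (swap x y) ℓ = -ℓ)) =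
      Multiset.card (L.filter fun ℓ => R ℓ = A ∧ C ℓ = B ∧ (A.card = 2 ∧
        ∀ x ∈ A, ∀ y ∈ A, x ≠ y → vact (K := ℂ) rowHom (swap x y) ℓ = -ℓ)) := by
  refine card_filter_eq_of_transport (vact (K := ℂ) colHom τ) (ActionSignCount.map_mk_map_vact_eq colHom hL1 hf0 hcol τ)
    _ _ (fun p q hpq => ?_) (fun ℓ => ?_)
  · obtain ⟨c, hc0, rfl⟩ := SupportBlocks.exists_C_of_associated hpq
    simp only [R1 p c hc0, C1 p c hc0, neg_iff_of_C_mul _ hc0]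
  · simp only [C2, RC, rowNeg_iff_of_col]
    constructor
    · rintro ⟨hR, hC, h2, hneg⟩
      exact ⟨hR, by simpa using congrArg (fun s => τ⁻¹ • s) hC, h2, hneg⟩
    · rintro ⟨hR, hC, h2, hneg⟩
      exact ⟨hR, by rw [hC], h2, hneg⟩

/-- **The column count is invariant under the column action.** [folklore] -/
theorem colCount_col
    (R1 : ∀ (q : MvPolynomial (Fin n × Fin n) ℂ) (u : ℂ), u ≠ 0 → R (MvPolynomial.C u * q) = R q)
    (C1 : ∀ (q : MvPolynomial (Fin n × Fin n) ℂ) (u : ℂ), u ≠ 0 → C (MvPolynomial.C u * q) = C q)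
    (C2 : ∀ (q : MvPolynomial (Fin n × Fin n) ℂ) (τ : Perm (Fin n)), C (vact (K := ℂ) colHom τ q) = τ • C q)
    (RC : ∀ (q : MvPolynomial (Fin n × Fin n) ℂ) (τ : Perm (Fin n)), R (vact (K := ℂ) colHom τ q) = R q)
    (hL1 : ∀ ℓ ∈ L, ℓ.totalDegree = 1) (hf0 : MvPolynomial.C a * L.prod ≠ 0)
    (hcol : ∀ τ : Perm (Fin n), vact (K := ℂ) colHom τ (MvPolynomial.C a * L.prod) = MvPolynomial.C a * L.prod)
    (τ : Perm (Fin n)) (A B : Finset (Fin n)) :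
    Multiset.card (L.filter fun ℓ => R ℓ = A ∧ C ℓ = τ • B ∧ ((τ • B).card = 2 ∧
        ∀ x ∈ τ • B, ∀ y ∈ τ • B, x ≠ y → vact (K := ℂ) colHom (swap x y) ℓ = -ℓ)) =
      Multiset.card (L.filter fun ℓ => R ℓ = A ∧ C ℓ = B ∧ (B.card = 2 ∧
        ∀ x ∈ B, ∀ y ∈ B, x ≠ y → vact (K := ℂ) colHom (swap x y) ℓ = -ℓ)) := by
  refine card_filter_eq_of_transport (vact (K := ℂ) colHom τ) (ActionSignCount.map_mk_map_vact_eq colHom hL1 hf0 hcol τ)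
    _ _ (fun p q hpq => ?_) (fun ℓ => ?_)
  · obtain ⟨c, hc0, rfl⟩ := SupportBlocks.exists_C_of_associated hpq
    simp only [R1 p c hc0, C1 p c hc0, neg_iff_of_C_mul _ hc0]
  · simp only [C2, RC, card_smul_finset]
    constructor
    · rintro ⟨hR, hC, h2, hneg⟩
      refine ⟨hR, by simpa using congrArg (fun s => τ⁻¹ • s) hC, h2, fun x hx y hy hxy => ?_⟩
      have := hneg (τ x) (smul_mem_smul_finset hx) (τ y) (smul_mem_smul_finset hy)
        (fun h => hxy (τ.injective h))
      exact (colNeg_iff_of_col τ x y ℓ).1 this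
    · rintro ⟨hR, hC, h2, hneg⟩
      refine ⟨hR, by rw [hC], h2, fun x hx y hy hxy => ?_⟩
      obtain ⟨x', hx', rfl⟩ := mem_smul_finset.1 hx
      obtain ⟨y', hy', rfl⟩ := mem_smul_finset.1 hy
      rw [Perm.smul_def, Perm.smul_def] at hxy ⊢
      exact (colNeg_iff_of_col τ x' y' ℓ).2 (hneg x' hx' y' hy' fun h => hxy (by rw [h]))

/-- **The column count is invariant under the row action.** [folklore] -/
theorem colCount_row
    (R1 : ∀ (q : MvPolynomial (Fin n × Fin n) ℂ) (u : ℂ), u ≠ 0 → R (MvPolynomial.C u * q) = R q)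
    (C1 : ∀ (q : MvPolynomial (Fin n × Fin n) ℂ) (u : ℂ), u ≠ 0 → C (MvPolynomial.C u * q) = C q)
    (R2 : ∀ (q : MvPolynomial (Fin n × Fin n) ℂ) (σ : Perm (Fin n)), R (vact (K := ℂ) rowHom σ q) = σ • R q)
    (CR : ∀ (q : MvPolynomial (Fin n × Fin n) ℂ) (σ : Perm (Fin n)), C (vact (K := ℂ) rowHom σ q) = C q)
    (hL1 : ∀ ℓ ∈ L, ℓ.totalDegree = 1) (hf0 : MvPolynomial.C a * L.prod ≠ 0)
    (hrow : ∀ σ : Perm (Fin n), vact (K := ℂ) rowHom σ (MvPolynomial.C a * L.prod) = MvPolynomial.C a * L.prod)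
    (σ : Perm (Fin n)) (A B : Finset (Fin n)) :
    Multiset.card (L.filter fun ℓ => R ℓ = σ • A ∧ C ℓ = B ∧ (B.card = 2 ∧
        ∀ x ∈ B, ∀ y ∈ B, x ≠ y → vact (K := ℂ) colHom (swap x y) ℓ = -ℓ)) =
      Multiset.card (L.filter fun ℓ => R ℓ = A ∧ C ℓ = B ∧ (B.card = 2 ∧
        ∀ x ∈ B, ∀ y ∈ B, x ≠ y → vact (K := ℂ) colHom (swap x y) ℓ = -ℓ)) := by
  refine card_filter_eq_of_transport (vact (K := ℂ) rowHom σ) (ActionSignCount.map_mk_map_vact_eq rowHom hL1 hf0 hrow σ)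
    _ _ (fun p q hpq => ?_) (fun ℓ => ?_)
  · obtain ⟨c, hc0, rfl⟩ := SupportBlocks.exists_C_of_associated hpq
    simp only [R1 p c hc0, C1 p c hc0, neg_iff_of_C_mul _ hc0]
  · simp only [R2, CR, colNeg_iff_of_row]
    constructor
    · rintro ⟨hR, hC, h2, hneg⟩
      exact ⟨by simpa using congrArg (fun s => σ⁻¹ • s) hR, hC, h2, hneg⟩
    · rintro ⟨hR, hC, h2, hneg⟩
      exact ⟨by rw [hR], hC, h2, hneg⟩

/-- **The row count is invariant under the diagonal action.** [folklore] -/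
theorem rowCount_ren
    (R1 : ∀ (q : MvPolynomial (Fin n × Fin n) ℂ) (u : ℂ), u ≠ 0 → R (MvPolynomial.C u * q) = R q)
    (C1 : ∀ (q : MvPolynomial (Fin n × Fin n) ℂ) (u : ℂ), u ≠ 0 → C (MvPolynomial.C u * q) = C q)
    (R2 : ∀ (q : MvPolynomial (Fin n × Fin n) ℂ) (σ : Perm (Fin n)), R (vact (K := ℂ) rowHom σ q) = σ • R q)
    (RC : ∀ (q : MvPolynomial (Fin n × Fin n) ℂ) (τ : Perm (Fin n)), R (vact (K := ℂ) colHom τ q) = R q)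
    (C2 : ∀ (q : MvPolynomial (Fin n × Fin n) ℂ) (τ : Perm (Fin n)), C (vact (K := ℂ) colHom τ q) = τ • C q)
    (CR : ∀ (q : MvPolynomial (Fin n × Fin n) ℂ) (σ : Perm (Fin n)), C (vact (K := ℂ) rowHom σ q) = C q)
    (hL1 : ∀ ℓ ∈ L, ℓ.totalDegree = 1) (hf0 : MvPolynomial.C a * L.prod ≠ 0)
    (hrow : ∀ σ : Perm (Fin n), vact (K := ℂ) rowHom σ (MvPolynomial.C a * L.prod) = MvPolynomial.C a * L.prod)
    (hcol : ∀ τ : Perm (Fin n), vact (K := ℂ) colHom τ (MvPolynomial.C a * L.prod) = MvPolynomial.C a * L.prod)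
    (σ : Perm (Fin n)) (A B : Finset (Fin n)) :
    Multiset.card (L.filter fun ℓ => R ℓ = σ • A ∧ C ℓ = σ • B ∧ ((σ • A).card = 2 ∧
        ∀ x ∈ σ • A, ∀ y ∈ σ • A, x ≠ y → vact (K := ℂ) rowHom (swap x y) ℓ = -ℓ)) =
      Multiset.card (L.filter fun ℓ => R ℓ = A ∧ C ℓ = B ∧ (A.card = 2 ∧
        ∀ x ∈ A, ∀ y ∈ A, x ≠ y → vact (K := ℂ) rowHom (swap x y) ℓ = -ℓ)) := by
  rw [rowCount_col R C R1 C1 C2 RC hL1 hf0 hcol σ (σ • A) B, rowCount_row R C R1 C1 R2 CR hL1 hf0 hrow σ A B]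

/-- **The column count is invariant under the diagonal action.** [folklore] -/
theorem colCount_ren
    (R1 : ∀ (q : MvPolynomial (Fin n × Fin n) ℂ) (u : ℂ), u ≠ 0 → R (MvPolynomial.C u * q) = R q)
    (C1 : ∀ (q : MvPolynomial (Fin n × Fin n) ℂ) (u : ℂ), u ≠ 0 → C (MvPolynomial.C u * q) = C q)
    (R2 : ∀ (q : MvPolynomial (Fin n × Fin n) ℂ) (σ : Perm (Fin n)), R (vact (K := ℂ) rowHom σ q) = σ • R q)
    (RC : ∀ (q : MvPolynomial (Fin n × Fin n) ℂ) (τ : Perm (Fin n)), R (vact (K := ℂ) colHom τ q) = R q)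
    (C2 : ∀ (q : MvPolynomial (Fin n × Fin n) ℂ) (τ : Perm (Fin n)), C (vact (K := ℂ) colHom τ q) = τ • C q)
    (CR : ∀ (q : MvPolynomial (Fin n × Fin n) ℂ) (σ : Perm (Fin n)), C (vact (K := ℂ) rowHom σ q) = C q)
    (hL1 : ∀ ℓ ∈ L, ℓ.totalDegree = 1) (hf0 : MvPolynomial.C a * L.prod ≠ 0)
    (hrow : ∀ σ : Perm (Fin n), vact (K := ℂ) rowHom σ (MvPolynomial.C a * L.prod) = MvPolynomial.C a * L.prod)
    (hcol : ∀ τ : Perm (Fin n), vact (K := ℂ) colHom τ (MvPolynomial.C a * L.prod) = MvPolynomial.C a * L.prod)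
    (σ : Perm (Fin n)) (A B : Finset (Fin n)) :
    Multiset.card (L.filter fun ℓ => R ℓ = σ • A ∧ C ℓ = σ • B ∧ ((σ • B).card = 2 ∧
        ∀ x ∈ σ • B, ∀ y ∈ σ • B, x ≠ y → vact (K := ℂ) colHom (swap x y) ℓ = -ℓ)) =
      Multiset.card (L.filter fun ℓ => R ℓ = A ∧ C ℓ = B ∧ (B.card = 2 ∧
        ∀ x ∈ B, ∀ y ∈ B, x ≠ y → vact (K := ℂ) colHom (swap x y) ℓ = -ℓ)) := by
  rw [colCount_row R C R1 C1 R2 CR hL1 hf0 hrow σ A (σ • B), colCount_col R C R1 C1 C2 RC hL1 hf0 hcol σ A B]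

end Counts

end KeyCounts

end Summit.ValiantsHypothesis.ValiantsHypothesis.Theorems

end
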